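import Literature.AlgebraicGeometry.ModuliOfAbelianVarieties.SymplecticLiftOfMarking           -- ★ (b) readings `exists_adelicCongr_inv_one`, `r_mem_torsionPoints_of_adelicCongr_one`, …
import Literature.AlgebraicGeometry.ModuliOfAbelianVarieties.SiegelAdelicMarkingCoverLevelReading -- ★ [L2-level] `mulVec_apply_mem_integralAdeles_of_forall_mem` (+ ★ `SiegelAdelicCongrTransport`)
import Literature.AlgebraicGeometry.AbelianSchemes.SymplecticLiftOfIsogenyTower                -- ★ `AbelianSchemeOver.fibreHom`
import Literature.AlgebraicGeometry.ModuliOfAbelianVarieties.SiegelPrincipalLevelOpen           -- ★ `isUnit_natCast_finAdeleQ`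
import Literature.NumberTheory.Adeles.IntegralAdelesReductionModN                              -- ★ reduction `ẑ → ℤ/M` (`exists_ringHom_integralAdeles_zmod`, level change)
import HarnessLib

/-!
# The PAIRING READING of a marked fibre moves along a cover `c` to the quotient marking `u′ = c ∘ u`, for representatives differing by a similitude
# `T = r′⁻¹ r` with `ν·T` integral and multiplier `ν⁻¹ε`, `ε ∈ ẑ^×` (mixed-level Weil clause as input)

Topic `AlgebraicGeometry/ModuliOfAbelianVarieties`; namespace `Literature.AlgebraicGeometry.ModuliOfAbelianVarieties`.  THEOREMS ONLY (no definition, no named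
fact, no instance, no notation, no `sorry`; net debt 0).  Cell `hodgecm-mathlib`, FLOOR 0, P6 «MOD programme» (crux hLiu418 = stmt-HodgeConjecture-24832,
`--supports`), X-LEAF sheet line, organ (S1b)(m4) road (β) (A-p01 (g28) 2026-09-02T06:25:25Z «file it as a ★ organ in marked-fibre currency that the (S8) closer
calls»), LAYER [L2-pair] — companion of ★ `SiegelAdelicMarkingCoverLevelReading` ([L2-level]) and ★ `SymplecticLiftableOfMarkedFibre` ([L1]).

SETTING.  `c : B → B′` a homomorphism of abelian schemes over `S`, `s` a complex point, `m` a marking of `B_s` by `[J, r′]` (torsion parametrisation `u = m.r`),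
`m′` a marking of `B′_s` by `[J′, r]` with `u′ = c_s ∘ u` (★ `SiegelAdelicMarkingIdealQuotient.exists_marking_of_idealKernel`: the 𝔞-quotient marking), and
`T := r′⁻¹ r ∈ GSp_δ(𝔸_f)` with (H1) `ν·T ∈ M_{2g}(ẑ)` and (H2) `ᵗT E_δ T = μ E_δ`, `ν μ = ε ∈ ẑ^×` (for the Serre twist by `𝔞` with `𝔞 𝔞̄ = (ν)`: `T` is the
matrix of `t⁻¹`, `𝔞̂ = t 𝒪̂ ∋ ν`, `ν∕(t t̄) ∈ 𝒪̂^×`).  INPUTS: the pairing reading `hpair` of `(B_s, Θ, u)` through `r′` for the compatible primitive roots `ζ`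
(verbatim the binder of ★ `exists_symplecticLift_of_levelReading`), and the MIXED-LEVEL WEIL CLAUSE (W′) «`ē^{Θ′}_M(c a, c b) = ē^{Θ}_{νM}(a, b)` for
`a, b ∈ B_s[νM]` over `c a, c b ∈ B′_s[M]`» — the conclusion of ★ `AbelianVariety.weilPairingLevel_map_map_eq_of_mixedLevel`, whose divisor clause for the exact
Serre twist is ★ `weilDiv_pullback_serreTranslate_linEquiv_nsmul_of_isExactTwistPol` ([L3], LA7-p01 (g3)).  OUTPUT: compatible primitive roots `ζ′`
(`ζ′_M = ζ_M^{ε mod M}`) and the pairing reading `hpair′` of `(B′_s, Θ′, u′)` through `r` — verbatim the `hpair` binder of ★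
`SymplecticLiftableOfMarkedFibre.isSymplecticLiftable_of_markedComplexFibre` at `(m′, r, Θ′, ζ′)`.

MATHEMATICS ([Milne2005ShimuraVarieties] §6 p. 75 «`ψ_N` corresponds to a `(ℤ∕Nℤ)^×`-multiple of `e_N`», Thm. 6.11; [Deligne1971TravauxShimura] 4.12 (b), 4.16;
[MumfordAV1970] §20 (1)–(3), §23 Thm. 2).  Read `P = u′(v) = c(u(v))` with `r⁻¹ v̂ ≡ x̃∕M`; then `ξ := M·r⁻¹v̂ ∈ ẑ^{2g}` reduces to `x` mod `M`, and
`νM · r′⁻¹ v̂ = (νT) ξ ∈ ẑ^{2g}`, so `u(v) ∈ B_s[νM]` is read through `r′` at the class `x′ := (νT)ξ mod νM`.  By (W′) and `hpair` at level `νM`,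
`ē^{Θ′}_M(P, Q) = ē^{Θ}_{νM}(u v, u w) = ζ_{νM}^{E_δ(x′, y′)}`, and `E_δ((νT)ξ, (νT)η) = ν²μ E_δ(ξ, η) = ν·ε·E_δ(ξ, η)`, whence
`ζ_{νM}^{E_δ(x′, y′)} = (ζ_{νM}^{ν})^{ε E_δ(ξ, η) mod M} = ζ_M^{ε̄ E_δ(x, y)} = (ζ′_M)^{E_δ(x, y)}`.

* §1 arithmetic of readings with denominator `n`: `adelicCongr_one_intDiv_iff` («`b v̂ ≡ z̃∕n` iff `n·b v̂ − z ∈ n·ẑ^{2g}`»), the Gram sum as a dot product and its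
  transformation under a similitude, its reduction modulo `n` (`typeFormMod`), and `ζ^a = ζ^b` for `a ≡ b (mod n)`;
* §2 **`SiegelAdelicMarking.pairingReading_comp_of_similitude`** — the theorem.

## References
* [Milne2005ShimuraVarieties] J. S. Milne, *Introduction to Shimura varieties* (2005), §6 Thm. 6.11 p. 74 and p. 75, §12 (63) p. 116.
* [Deligne1971TravauxShimura] P. Deligne, *Travaux de Shimura*, Sém. Bourbaki 389 (1971), 4.12 (b) p. 149, 4.16 p. 150.
* [MumfordAV1970] D. Mumford, *Abelian Varieties* (1970), §20 (pp. 184–186), §23 Thm. 2 (p. 231).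
* [Lan2013PELCompactifications] K.-W. Lan, *Arithmetic compactifications of PEL-type Shimura varieties* (2013), §1.3.6 Lemma 1.3.6.5 (p. 81).
-/

set_option autoImplicit false

noncomputable section

open Matrix CategoryTheory AlgebraicGeometry NumberField IsDedekindDomain
open Literature.AlgebraicGeometry.Motives (AbelianVariety AlgPoints CartierDivisor)
open Literature.AlgebraicGeometry.AbelianSchemes (AbelianSchemeOver)
open Literature.NumberTheory.Adeles (latticeOfGL exists_ringHom_integralAdeles_zmod ringHom_integralAdeles_zmod_apply_eq_intCast_iff
  castHom_comp_ringHom_integralAdeles_zmod_eq)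

namespace Literature.AlgebraicGeometry.ModuliOfAbelianVarieties

variable {g : ℕ} {δ : Fin g → ℕ}

/-! ## §1 Arithmetic of readings with denominator `n` -/

/-- **Readings with denominator `n`**: `b v̂ ≡ z̃∕n (mod ẑ^{2g})` iff `n·(b v̂) − z ∈ n·ẑ^{2g}` coordinatewise (`n ≠ 0`, `z` an integer vector).
[cite: Milne2005ShimuraVarieties, §6 Thm. 6.11 p. 74 and p. 75] -/
theorem adelicCongr_one_intDiv_iff {b : GL (Fin g ⊕ Fin g) finAdeleQ} {v : Fin g ⊕ Fin g → ℚ} {n : ℕ} (hn : n ≠ 0)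
    (z : Fin g ⊕ Fin g → ℤ) :
    AdelicCongr b 1 v (fun i => (z i : ℚ) / n) ↔
      ∀ i, (n : finAdeleQ) * ((b : Matrix (Fin g ⊕ Fin g) (Fin g ⊕ Fin g) finAdeleQ) *ᵥ adelicVec v) i - (z i : finAdeleQ) ∈ levelIdeal n := by
  have hq : ∀ i, (n : finAdeleQ) * adelicVec (fun i => (z i : ℚ) / n) i = (z i : finAdeleQ) := by
    intro i
    rw [adelicVec_apply, ← map_natCast (algebraMap ℚ finAdeleQ) n, ← map_mul, mul_div_cancel₀ _ (Nat.cast_ne_zero.2 hn : (n : ℚ) ≠ 0),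
      map_intCast]
  refine forall_congr' fun i => ?_
  rw [Units.val_one, Matrix.one_mulVec, Pi.sub_apply, mem_levelIdeal_iff]
  constructor
  · intro h
    refine ⟨_, h, ?_⟩
    rw [mul_sub, hq]
  · rintro ⟨y, hy, hny⟩
    have e : ((b : Matrix (Fin g ⊕ Fin g) (Fin g ⊕ Fin g) finAdeleQ) *ᵥ adelicVec v) i - adelicVec (fun i => (z i : ℚ) / n) i = y := by
      refine ((isUnit_natCast_finAdeleQ hn).mul_right_inj).1 ?_
      rw [mul_sub, hq, hny]
    rw [e]
    exact hy

/-- The Gram sum `Σᵢⱼ Xᵢ (E_δ)ᵢⱼ Yⱼ` is the dot product `X · (E_δ Y)`. [cite: Milne2005ShimuraVarieties, §6 p. 67] -/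
theorem sum_sum_mul_typeForm_mul_eq_dotProduct {R : Type*} [CommRing R] (X Y : Fin g ⊕ Fin g → R) :
    ∑ i, ∑ j, X i * ((typeForm δ i j : ℤ) : R) * Y j = X ⬝ᵥ (typeFormOver δ R *ᵥ Y) := by
  simp only [dotProduct, Matrix.mulVec, typeFormOver_apply, Finset.mul_sum, mul_assoc]

/-- **A similitude rescales the Gram sum**: `ᵗG E_δ G = c·E_δ` ⟹ `(Gξ) · E_δ (Gη) = c · (ξ · E_δ η)`. [cite: Milne2005ShimuraVarieties, §6 p. 67 (ν(g))] -/
theorem dotProduct_mulVec_typeFormOver_mulVec_of_transpose_mul_mul {R : Type*} [CommRing R]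
    {G : Matrix (Fin g ⊕ Fin g) (Fin g ⊕ Fin g) R} {c : R} (hG : Gᵀ * typeFormOver δ R * G = c • typeFormOver δ R)
    (ξ η : Fin g ⊕ Fin g → R) :
    (G *ᵥ ξ) ⬝ᵥ (typeFormOver δ R *ᵥ (G *ᵥ η)) = c * (ξ ⬝ᵥ (typeFormOver δ R *ᵥ η)) := by
  rw [← Matrix.vecMul_transpose, ← Matrix.dotProduct_mulVec, Matrix.mulVec_mulVec, Matrix.mulVec_mulVec, hG, Matrix.smul_mulVec,
    dotProduct_smul, smul_eq_mul]

/-- **Reduction of the Gram sum modulo `n`**: a ring homomorphism `ρ : ẑ → ℤ∕n` carries `Σᵢⱼ Xᵢ (E_δ)ᵢⱼ Yⱼ` (integral vectors) to `E_δ mod n` of the reductions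
(★ `typeFormMod`). [cite: Milne2005ShimuraVarieties, §6 Thm. 6.11 p. 74 and p. 75] -/
theorem ringHom_sum_sum_mul_typeForm_mul {n : ℕ} (ρ : FiniteAdeleRing.integralAdeles (𝓞 ℚ) ℚ →+* ZMod n)
    (X Y : Fin g ⊕ Fin g → FiniteAdeleRing.integralAdeles (𝓞 ℚ) ℚ) :
    ρ (∑ i, ∑ j, X i * ((typeForm δ i j : ℤ) : FiniteAdeleRing.integralAdeles (𝓞 ℚ) ℚ) * Y j) =
      AbelianSchemeOver.typeFormMod δ n (fun i => ρ (X i)) (fun j => ρ (Y j)) := by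
  simp only [map_sum, map_mul, map_intCast, AbelianSchemeOver.typeFormMod_apply]

/-- Powers of a primitive `n`-th root only depend on the exponent modulo `n`. [cite: Milne2005ShimuraVarieties, §6 p. 75] -/
theorem primitiveRoot_pow_eq_pow_of_modEq {K : Type*} [CommMonoid K] {ζ : K} {n : ℕ} (h : IsPrimitiveRoot ζ n) {a b : ℕ}
    (hab : a ≡ b [MOD n]) : ζ ^ a = ζ ^ b := by
  rw [← Nat.mod_add_div a n, ← Nat.mod_add_div b n, pow_add, pow_add, pow_mul, pow_mul, h.pow_eq_one, one_pow, one_pow, mul_one, mul_one,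
    show a % n = b % n from hab]

/-! ## §2 The pairing reading moves along the cover to the quotient marking -/

/-- **`hpair` FOR THE QUOTIENT MARKING.**  Let `c : B → B′` be a homomorphism of abelian schemes over `S`, `s` a complex point, `m` a marking of `B_s` by `[J, r′]`
and `m′` a marking of `B′_s` by `[J′, r]` with `u′ = c_s ∘ u`, and let `T := r′⁻¹ r` satisfy (H1) `ν·T ∈ M_{2g}(ẑ)` and (H2) `ᵗT E_δ T = μ·E_δ` with
`ν·μ = ε ∈ ẑ^×`.  If the Weil pairing of `Θ` on `B_s` is read through `r′` in `δ`-normal form for the compatible primitive roots `ζ` (`hpair`), and `c_s`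
satisfies the mixed-level Weil clause «`ē^{Θ′}_M(c a, c b) = ē^{Θ}_{νM}(a, b)`» (`hW`, ★ `weilPairingLevel_map_map_eq_of_mixedLevel`), then the Weil pairing
of `Θ′` on `B′_s` is read through `r` in `δ`-normal form for the compatible primitive roots `ζ′_M := ζ_M^{ε mod M}` — the `hpair` binder of ★
`isSymplecticLiftable_of_markedComplexFibre` at `(m′, r, Θ′, ζ′)`. [cite: Milne2005ShimuraVarieties, §6 Thm. 6.11 p. 74 and p. 75, §12 (63) p. 116]
[cite: Deligne1971TravauxShimura, 4.12 (b) p. 149 and 4.16 p. 150] [cite: MumfordAV1970, §20 (properties (1)–(3) of e_n, pp. 184–186) and §23 (Thm. 2, p. 231)] -/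
theorem SiegelAdelicMarking.pairingReading_comp_of_similitude {J J' : C0pm δ} {r' r : gspFinAdelic δ}
    {S : Scheme.{0}} {B B' : AbelianSchemeOver S} {s : Spec (.of ℂ) ⟶ S} (c : B.X ⟶ B'.X) [IsMonHom c]
    (m : SiegelAdelicMarking J r' (B.fibre s).toAbelianVariety) (m' : SiegelAdelicMarking J' r (B'.fibre s).toAbelianVariety)
    (hm' : ∀ v, m'.r v = AlgPoints.map (AbelianSchemeOver.fibreHom c s).hom.hom.hom (m.r v))
    {N ν : ℕ} (hν : ν ≠ 0)
    (hT : ∀ i j, (ν : finAdeleQ) *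
      (((r'⁻¹ * r : gspFinAdelic δ) : GL (Fin g ⊕ Fin g) finAdeleQ) : Matrix (Fin g ⊕ Fin g) (Fin g ⊕ Fin g) finAdeleQ) i j ∈
        FiniteAdeleRing.integralAdeles (𝓞 ℚ) ℚ)
    {μ : finAdeleQˣ} (hμ : IsMultiplier (typeFormOver δ finAdeleQ) ((r'⁻¹ * r : gspFinAdelic δ) : GL (Fin g ⊕ Fin g) finAdeleQ) μ)
    (ε : (FiniteAdeleRing.integralAdeles (𝓞 ℚ) ℚ)ˣ)
    (hε : ((ε : FiniteAdeleRing.integralAdeles (𝓞 ℚ) ℚ) : finAdeleQ) = (ν : finAdeleQ) * (μ : finAdeleQ))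
    (Θ : CartierDivisor (B.fibre s).toAbelianVariety.X.left) (Θ' : CartierDivisor (B'.fibre s).toAbelianVariety.X.left)
    (ζ : ℕ → ℂ) (hζ : ∀ ⦃M : ℕ⦄, N ∣ M → M ≠ 0 → IsPrimitiveRoot (ζ M) M)
    (hζ_pow : ∀ ⦃M : ℕ⦄ (k : ℕ), N ∣ M → M ≠ 0 → k ≠ 0 → ζ (k * M) ^ k = ζ M)
    (hpair : ∀ ⦃M : ℕ⦄, N ∣ M → ∀ (hMΩ : (M : ℂ) ≠ 0) (x y : Fin g ⊕ Fin g → ZMod M)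
      (P Q : (B.fibre s).toAbelianVariety.torsionPoints ℂ (M : ℤ)),
      (∀ v, AdelicCongr ((r'⁻¹ : gspFinAdelic δ) : GL (Fin g ⊕ Fin g) finAdeleQ) 1 v
          (fun i => ((x i).val : ℚ) / M) → (P : (B.fibre s).toAbelianVariety.Points ℂ) = m.r v) →
      (∀ w, AdelicCongr ((r'⁻¹ : gspFinAdelic δ) : GL (Fin g ⊕ Fin g) finAdeleQ) 1 w
          (fun i => ((y i).val : ℚ) / M) → (Q : (B.fibre s).toAbelianVariety.Points ℂ) = m.r w) →
      haveI := AbelianVariety.isDominant_toSchemeHom_zsmul_of_ne_zero (B.fibre s).toAbelianVariety hMΩ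
      (B.fibre s).toAbelianVariety.weilPairingLevel Θ P Q = ζ M ^ (AbelianSchemeOver.typeFormMod δ M x y).val)
    (hW : ∀ ⦃M : ℕ⦄, N ∣ M → ∀ (hMΩ : (M : ℂ) ≠ 0) (hνMΩ : ((ν * M : ℕ) : ℂ) ≠ 0)
      (a b : (B.fibre s).toAbelianVariety.torsionPoints ℂ ((ν * M : ℕ) : ℤ))
      (P Q : (B'.fibre s).toAbelianVariety.torsionPoints ℂ (M : ℤ)),
      (P : (B'.fibre s).toAbelianVariety.Points ℂ) = AlgPoints.map (AbelianSchemeOver.fibreHom c s).hom.hom.hom a.1 →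
      (Q : (B'.fibre s).toAbelianVariety.Points ℂ) = AlgPoints.map (AbelianSchemeOver.fibreHom c s).hom.hom.hom b.1 →
      haveI := AbelianVariety.isDominant_toSchemeHom_zsmul_of_ne_zero (B'.fibre s).toAbelianVariety hMΩ
      haveI := AbelianVariety.isDominant_toSchemeHom_zsmul_of_ne_zero (B.fibre s).toAbelianVariety hνMΩ
      (B'.fibre s).toAbelianVariety.weilPairingLevel Θ' P Q =
        (B.fibre s).toAbelianVariety.weilPairingLevel (N := ν * M) Θ a b) :
    ∃ ζ' : ℕ → ℂ, (∀ ⦃M : ℕ⦄, N ∣ M → M ≠ 0 → IsPrimitiveRoot (ζ' M) M) ∧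
      (∀ ⦃M : ℕ⦄ (k : ℕ), N ∣ M → M ≠ 0 → k ≠ 0 → ζ' (k * M) ^ k = ζ' M) ∧
      ∀ ⦃M : ℕ⦄, N ∣ M → ∀ (hMΩ : (M : ℂ) ≠ 0) (x y : Fin g ⊕ Fin g → ZMod M)
        (P Q : (B'.fibre s).toAbelianVariety.torsionPoints ℂ (M : ℤ)),
        (∀ v, AdelicCongr ((r⁻¹ : gspFinAdelic δ) : GL (Fin g ⊕ Fin g) finAdeleQ) 1 v
            (fun i => ((x i).val : ℚ) / M) → (P : (B'.fibre s).toAbelianVariety.Points ℂ) = m'.r v) →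
        (∀ w, AdelicCongr ((r⁻¹ : gspFinAdelic δ) : GL (Fin g ⊕ Fin g) finAdeleQ) 1 w
            (fun i => ((y i).val : ℚ) / M) → (Q : (B'.fibre s).toAbelianVariety.Points ℂ) = m'.r w) →
        haveI := AbelianVariety.isDominant_toSchemeHom_zsmul_of_ne_zero (B'.fibre s).toAbelianVariety hMΩ
        (B'.fibre s).toAbelianVariety.weilPairingLevel Θ' P Q = ζ' M ^ (AbelianSchemeOver.typeFormMod δ M x y).val := by
  classical
  -- the reduction homomorphisms `ρ_M : ẑ → ℤ/M` (chosen once for every `M ≠ 0`) and the twisted roots `ζ′_M := ζ_M ^ (ρ_M ε)`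
  have hρex : ∀ M : ℕ, M ≠ 0 → ∃ ρ : FiniteAdeleRing.integralAdeles (𝓞 ℚ) ℚ →+* ZMod M,
      ∀ (x : FiniteAdeleRing.integralAdeles (𝓞 ℚ) ℚ) (a : ℤ), (x : finAdeleQ) - (a : finAdeleQ) ∈ levelIdeal M → ρ x = a :=
    fun M hM => exists_ringHom_integralAdeles_zmod hM
  let expo : ℕ → ℕ := fun M => if hM : M = 0 then 0 else ((Classical.choose (hρex M hM)) (ε : FiniteAdeleRing.integralAdeles (𝓞 ℚ) ℚ)).val
  have hexpo : ∀ {M : ℕ} (hM : M ≠ 0), expo M = ((Classical.choose (hρex M hM)) (ε : FiniteAdeleRing.integralAdeles (𝓞 ℚ) ℚ)).val :=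
    fun hM => dif_neg hM
  -- residues of `ε` are units, and compatible in the tower
  have hunit : ∀ {M : ℕ} (hM : M ≠ 0), (expo M).Coprime M := by
    intro M hM
    rw [hexpo hM]
    obtain ⟨u, hu⟩ := (Units.isUnit ε).map (Classical.choose (hρex M hM))
    rw [← hu]
    exact ZMod.val_coe_unit_coprime u
  have hcompat : ∀ {M k : ℕ} (hM : M ≠ 0) (hk : k ≠ 0), expo (k * M) ≡ expo M [MOD M] := by
    intro M k hM hk
    have hkM : k * M ≠ 0 := mul_ne_zero hk hM
    rw [hexpo hM, hexpo hkM]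
    have hc := castHom_comp_ringHom_integralAdeles_zmod_eq (N := M) hkM (Dvd.intro_left k rfl)
      (Classical.choose_spec (hρex (k * M) hkM)) (Classical.choose_spec (hρex M hM))
    have happ := congrArg (fun f => (f (ε : FiniteAdeleRing.integralAdeles (𝓞 ℚ) ℚ)).val) hc
    simp only [RingHom.comp_apply, ZMod.castHom_apply] at happ
    haveI : NeZero (k * M) := ⟨hkM⟩
    rw [ZMod.cast_eq_val, ZMod.val_natCast] at happ
    -- `happ : expo (kM) % M = expo M`
    exact (Nat.mod_modEq _ _).symm.trans (happ ▸ Nat.ModEq.refl _)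
  refine ⟨fun M => ζ M ^ expo M, fun M hNM hM => (hζ hNM hM).pow_of_coprime _ (hunit hM), fun M k hNM hM hk => ?_, ?_⟩
  · -- tower: `(ζ_{kM}^{ε̄})^k = (ζ_{kM}^k)^{ε̄} = ζ_M^{ε̄ mod M}`
    change (ζ (k * M) ^ expo (k * M)) ^ k = ζ M ^ expo M
    rw [← pow_mul, mul_comm (expo (k * M)) k, pow_mul, hζ_pow k hNM hM hk]
    exact primitiveRoot_pow_eq_pow_of_modEq (hζ hNM hM) (hcompat hM hk)
  -- THE PAIRING CLAUSE
  intro M hNM hMΩ x y P Q hP hQ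
  have hM : M ≠ 0 := by rintro rfl; exact hMΩ Nat.cast_zero
  have hνM : ν * M ≠ 0 := mul_ne_zero hν hM
  have hνMΩ : ((ν * M : ℕ) : ℂ) ≠ 0 := Nat.cast_ne_zero.2 hνM
  haveI : NeZero M := ⟨hM⟩
  haveI : NeZero (ν * M) := ⟨hνM⟩
  change _ = (ζ M ^ expo M) ^ _
  rw [hexpo hM]
  -- the two reduction maps `ρ = ρ_M`, `ρ′ = ρ_{νM}` and their specifications, `ρ = (ℤ/νM → ℤ/M) ∘ ρ′`
  set ρ := Classical.choose (hρex M hM) with hρdef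
  have hρ := Classical.choose_spec (hρex M hM)
  set ρ' := Classical.choose (hρex (ν * M) hνM) with hρ'def
  have hρ' := Classical.choose_spec (hρex (ν * M) hνM)
  have hcast : (ZMod.castHom (dvd_mul_left M ν) (ZMod M)).comp ρ' = ρ :=
    castHom_comp_ringHom_integralAdeles_zmod_eq (N := M) hνM (dvd_mul_left M ν) hρ' hρ
  -- STEP 1: `r`-partners `v, w` of `x̃/M`, `ỹ/M`; `P = c(u v)`, `Q = c(u w)`
  obtain ⟨v, hv⟩ := SiegelAdelicMarking.exists_adelicCongr_inv_one (a := r) (fun i => ((x i).val : ℚ) / M)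
  obtain ⟨w, hw⟩ := SiegelAdelicMarking.exists_adelicCongr_inv_one (a := r) (fun i => ((y i).val : ℚ) / M)
  have hPv : (P : (B'.fibre s).toAbelianVariety.Points ℂ) = AlgPoints.map (AbelianSchemeOver.fibreHom c s).hom.hom.hom (m.r v) := by
    rw [← hm']; exact hP v hv
  have hQw : (Q : (B'.fibre s).toAbelianVariety.Points ℂ) = AlgPoints.map (AbelianSchemeOver.fibreHom c s).hom.hom.hom (m.r w) := by
    rw [← hm']; exact hQ w hw
  -- STEP 2: the integral vectors `ξ = M·r⁻¹v̂ ≡ x`, `η = M·r⁻¹ŵ ≡ y (mod M)` and `X′ = (νT)ξ = νM·r′⁻¹v̂`, `Y′ = (νT)η`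
  set Rm := (((r⁻¹ : gspFinAdelic δ) : GL (Fin g ⊕ Fin g) finAdeleQ) : Matrix (Fin g ⊕ Fin g) (Fin g ⊕ Fin g) finAdeleQ) with hRm
  set R'm := (((r'⁻¹ : gspFinAdelic δ) : GL (Fin g ⊕ Fin g) finAdeleQ) : Matrix (Fin g ⊕ Fin g) (Fin g ⊕ Fin g) finAdeleQ) with hR'm
  set Tm := (((r'⁻¹ * r : gspFinAdelic δ) : GL (Fin g ⊕ Fin g) finAdeleQ) : Matrix (Fin g ⊕ Fin g) (Fin g ⊕ Fin g) finAdeleQ) with hTm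
  have hsplit : R'm = Tm * Rm := by
    rw [hR'm, hTm, hRm, ← Units.val_mul, ← Subgroup.coe_mul, mul_assoc, mul_inv_cancel, mul_one]
  have hξ : ∀ i, (M : finAdeleQ) * (Rm *ᵥ adelicVec v) i - ((((x i).val : ℤ)) : finAdeleQ) ∈ levelIdeal M :=
    (adelicCongr_one_intDiv_iff hM fun i => ((x i).val : ℤ)).1 (by simpa only [Int.cast_natCast] using hv)
  have hη : ∀ i, (M : finAdeleQ) * (Rm *ᵥ adelicVec w) i - ((((y i).val : ℤ)) : finAdeleQ) ∈ levelIdeal M :=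
    (adelicCongr_one_intDiv_iff hM fun i => ((y i).val : ℤ)).1 (by simpa only [Int.cast_natCast] using hw)
  have hξint : ∀ i, (M : finAdeleQ) * (Rm *ᵥ adelicVec v) i ∈ FiniteAdeleRing.integralAdeles (𝓞 ℚ) ℚ := fun i => by
    simpa only [sub_add_cancel] using add_mem (mem_integralAdeles_of_mem_levelIdeal (hξ i))
      (intCast_mem (FiniteAdeleRing.integralAdeles (𝓞 ℚ) ℚ) ((x i).val : ℤ))
  have hηint : ∀ i, (M : finAdeleQ) * (Rm *ᵥ adelicVec w) i ∈ FiniteAdeleRing.integralAdeles (𝓞 ℚ) ℚ := fun i => by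
    simpa only [sub_add_cancel] using add_mem (mem_integralAdeles_of_mem_levelIdeal (hη i))
      (intCast_mem (FiniteAdeleRing.integralAdeles (𝓞 ℚ) ℚ) ((y i).val : ℤ))
  let ξ : Fin g ⊕ Fin g → FiniteAdeleRing.integralAdeles (𝓞 ℚ) ℚ := fun i => ⟨(M : finAdeleQ) * (Rm *ᵥ adelicVec v) i, hξint i⟩
  let η : Fin g ⊕ Fin g → FiniteAdeleRing.integralAdeles (𝓞 ℚ) ℚ := fun i => ⟨(M : finAdeleQ) * (Rm *ᵥ adelicVec w) i, hηint i⟩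
  have hρξ : (fun i => ρ (ξ i)) = x := funext fun i => by
    rw [hρ (ξ i) ((x i).val : ℤ) (hξ i), Int.cast_natCast, ZMod.natCast_zmod_val]
  have hρη : (fun i => ρ (η i)) = y := funext fun i => by
    rw [hρ (η i) ((y i).val : ℤ) (hη i), Int.cast_natCast, ZMod.natCast_zmod_val]
  -- `G := ν·T` is integral with `ᵗG E_δ G = (ν·ν·μ)·E_δ`
  have hG : ∀ i j, ((ν : finAdeleQ) • Tm) i j ∈ FiniteAdeleRing.integralAdeles (𝓞 ℚ) ℚ := fun i j => by
    rw [Matrix.smul_apply, smul_eq_mul]; exact hT i j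
  have hGE : ((ν : finAdeleQ) • Tm)ᵀ * typeFormOver δ finAdeleQ * ((ν : finAdeleQ) • Tm) =
      ((ν : finAdeleQ) * ((ν : finAdeleQ) * (μ : finAdeleQ))) • typeFormOver δ finAdeleQ := by
    rw [Matrix.transpose_smul, Matrix.smul_mul, Matrix.smul_mul, Matrix.mul_smul, hTm, isMultiplier_iff.1 hμ, smul_smul, smul_smul, mul_assoc]
  have hX'int : ∀ i, (((ν : finAdeleQ) • Tm) *ᵥ fun j => (ξ j : finAdeleQ)) i ∈ FiniteAdeleRing.integralAdeles (𝓞 ℚ) ℚ :=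
    mulVec_apply_mem_integralAdeles_of_forall_mem hG fun j => (ξ j).2
  have hY'int : ∀ i, (((ν : finAdeleQ) • Tm) *ᵥ fun j => (η j : finAdeleQ)) i ∈ FiniteAdeleRing.integralAdeles (𝓞 ℚ) ℚ :=
    mulVec_apply_mem_integralAdeles_of_forall_mem hG fun j => (η j).2
  let X' : Fin g ⊕ Fin g → FiniteAdeleRing.integralAdeles (𝓞 ℚ) ℚ := fun i => ⟨_, hX'int i⟩
  let Y' : Fin g ⊕ Fin g → FiniteAdeleRing.integralAdeles (𝓞 ℚ) ℚ := fun i => ⟨_, hY'int i⟩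
  -- `νM · r′⁻¹ v̂ = X′`
  have hkey : ∀ (u : Fin g ⊕ Fin g → ℚ) (i : Fin g ⊕ Fin g), ((ν * M : ℕ) : finAdeleQ) * (R'm *ᵥ adelicVec u) i =
      (((ν : finAdeleQ) • Tm) *ᵥ fun j => (M : finAdeleQ) * (Rm *ᵥ adelicVec u) j) i := by
    intro u i
    have e : (fun j => (M : finAdeleQ) * (Rm *ᵥ adelicVec u) j) = (M : finAdeleQ) • (Rm *ᵥ adelicVec u) := rfl
    rw [e, hsplit, ← Matrix.mulVec_mulVec, Matrix.smul_mulVec, Matrix.mulVec_smul, Pi.smul_apply, Pi.smul_apply, smul_eq_mul, smul_eq_mul,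
      Nat.cast_mul, mul_assoc]
  -- the `r′`-reading classes `x′ := X′ mod νM`, `y′ := Y′ mod νM` of `v`, `w`
  let x' : Fin g ⊕ Fin g → ZMod (ν * M) := fun i => ρ' (X' i)
  let y' : Fin g ⊕ Fin g → ZMod (ν * M) := fun i => ρ' (Y' i)
  have hv' : AdelicCongr ((r'⁻¹ : gspFinAdelic δ) : GL (Fin g ⊕ Fin g) finAdeleQ) 1 v (fun i => ((x' i).val : ℚ) / (ν * M : ℕ)) := by
    have h := (adelicCongr_one_intDiv_iff (b := ((r'⁻¹ : gspFinAdelic δ) : GL (Fin g ⊕ Fin g) finAdeleQ)) (v := v) hνM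
      fun i => ((x' i).val : ℤ)).2 fun i => by
        rw [← hR'm, hkey v i]
        exact (ringHom_integralAdeles_zmod_apply_eq_intCast_iff hνM hρ' (X' i) ((x' i).val : ℤ)).1
          (by rw [Int.cast_natCast, ZMod.natCast_zmod_val])
    simpa only [Int.cast_natCast] using h
  have hw' : AdelicCongr ((r'⁻¹ : gspFinAdelic δ) : GL (Fin g ⊕ Fin g) finAdeleQ) 1 w (fun i => ((y' i).val : ℚ) / (ν * M : ℕ)) := by
    have h := (adelicCongr_one_intDiv_iff (b := ((r'⁻¹ : gspFinAdelic δ) : GL (Fin g ⊕ Fin g) finAdeleQ)) (v := w) hνM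
      fun i => ((y' i).val : ℤ)).2 fun i => by
        rw [← hR'm, hkey w i]
        exact (ringHom_integralAdeles_zmod_apply_eq_intCast_iff hνM hρ' (Y' i) ((y' i).val : ℤ)).1
          (by rw [Int.cast_natCast, ZMod.natCast_zmod_val])
    simpa only [Int.cast_natCast] using h
  -- STEP 3: `u v, u w ∈ B_s[νM]`, read through `r′` at `x′`, `y′`
  have ha : m.r v ∈ (B.fibre s).toAbelianVariety.torsionPoints ℂ ((ν * M : ℕ) : ℤ) :=
    m.r_mem_torsionPoints_of_adelicCongr_one hv' (SiegelAdelicMarking.nsmul_valDiv_mem_latticeOfGL_one (ν * M) x')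
  have hb : m.r w ∈ (B.fibre s).toAbelianVariety.torsionPoints ℂ ((ν * M : ℕ) : ℤ) :=
    m.r_mem_torsionPoints_of_adelicCongr_one hw' (SiegelAdelicMarking.nsmul_valDiv_mem_latticeOfGL_one (ν * M) y')
  -- STEP 4: (W′) and `hpair` at level `νM`
  have hWab := hW hNM hMΩ hνMΩ ⟨m.r v, ha⟩ ⟨m.r w, hb⟩ P Q hPv hQw
  have hpair' := hpair (hNM.mul_left ν) hνMΩ x' y' ⟨m.r v, ha⟩ ⟨m.r w, hb⟩
    (fun v₁ hv₁ => m.forall_eq_r_of_adelicCongr_one hv' rfl v₁ hv₁) (fun w₁ hw₁ => m.forall_eq_r_of_adelicCongr_one hw' rfl w₁ hw₁)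
  rw [hWab, hpair']
  -- STEP 5: the exponent: `E_δ(x′, y′) = ν·e₀ (mod νM)` and `e₀ = ε̄·E_δ(x, y) (mod M)` for `e₀ := (ε·E_δ(ξ, η)) mod νM`
  let Sb : FiniteAdeleRing.integralAdeles (𝓞 ℚ) ℚ := ∑ i, ∑ j, ξ i * ((typeForm δ i j : ℤ) : FiniteAdeleRing.integralAdeles (𝓞 ℚ) ℚ) * η j
  let e₀ : ℕ := (ρ' ((ε : FiniteAdeleRing.integralAdeles (𝓞 ℚ) ℚ) * Sb)).val
  have hS' : ∑ i, ∑ j, X' i * ((typeForm δ i j : ℤ) : FiniteAdeleRing.integralAdeles (𝓞 ℚ) ℚ) * Y' j =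
      (ν : FiniteAdeleRing.integralAdeles (𝓞 ℚ) ℚ) * ((ε : FiniteAdeleRing.integralAdeles (𝓞 ℚ) ℚ) * Sb) := by
    have hA : ∑ i, ∑ j, (X' i : finAdeleQ) * ((typeForm δ i j : ℤ) : finAdeleQ) * (Y' j : finAdeleQ) =
        (ν : finAdeleQ) * (((ε : FiniteAdeleRing.integralAdeles (𝓞 ℚ) ℚ) : finAdeleQ) *
          ∑ i, ∑ j, (ξ i : finAdeleQ) * ((typeForm δ i j : ℤ) : finAdeleQ) * (η j : finAdeleQ)) := by
      rw [sum_sum_mul_typeForm_mul_eq_dotProduct, sum_sum_mul_typeForm_mul_eq_dotProduct, hε]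
      change (((ν : finAdeleQ) • Tm) *ᵥ fun j => (ξ j : finAdeleQ)) ⬝ᵥ
          (typeFormOver δ finAdeleQ *ᵥ (((ν : finAdeleQ) • Tm) *ᵥ fun j => (η j : finAdeleQ))) = _
      rw [dotProduct_mulVec_typeFormOver_mulVec_of_transpose_mul_mul hGE]
      ring
    apply Subtype.ext
    push_cast [Sb]
    exact hA
  have hi : AbelianSchemeOver.typeFormMod δ (ν * M) x' y' = ((ν * e₀ : ℕ) : ZMod (ν * M)) := by
    change AbelianSchemeOver.typeFormMod δ (ν * M) (fun i => ρ' (X' i)) (fun j => ρ' (Y' j)) = _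
    rw [← ringHom_sum_sum_mul_typeForm_mul, hS', map_mul, map_natCast, Nat.cast_mul, ZMod.natCast_zmod_val]
  have hii : (e₀ : ZMod M) = ρ (ε : FiniteAdeleRing.integralAdeles (𝓞 ℚ) ℚ) * AbelianSchemeOver.typeFormMod δ M x y := by
    rw [← ZMod.cast_eq_val, ← ZMod.castHom_apply (R := ZMod M) (h := dvd_mul_left M ν), ← RingHom.comp_apply, hcast, map_mul,
      ringHom_sum_sum_mul_typeForm_mul, hρξ, hρη]
  -- conclude
  have hL : ζ (ν * M) ^ (AbelianSchemeOver.typeFormMod δ (ν * M) x' y').val = ζ M ^ e₀ := by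
    rw [hi, ZMod.val_natCast, primitiveRoot_pow_eq_pow_of_modEq (hζ (hNM.mul_left ν) hνM) (Nat.mod_modEq _ _), pow_mul,
      hζ_pow ν hNM hM hν]
  have hR : (ζ M ^ (ρ (ε : FiniteAdeleRing.integralAdeles (𝓞 ℚ) ℚ)).val) ^ (AbelianSchemeOver.typeFormMod δ M x y).val = ζ M ^ e₀ := by
    rw [← pow_mul]
    refine primitiveRoot_pow_eq_pow_of_modEq (hζ hNM hM) ?_
    have h := congrArg ZMod.val hii
    rw [ZMod.val_natCast, ZMod.val_mul] at h
    exact (Nat.mod_modEq _ _).symm.trans ((h.trans rfl) ▸ Nat.mod_modEq _ _)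
  rw [hL, hR]

end Literature.AlgebraicGeometry.ModuliOfAbelianVarieties

end
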